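import Summits.ValiantsHypothesis.ValiantsHypothesis.Theorems.KPlusLogSqLawRealStaticNormalForm
import Summits.ValiantsHypothesis.ValiantsHypothesis.Theorems.LacunarySymmetroidMatrixDescartesCensusFormatMonotone

/-!
# Route «KPlusLogSqLaw» — DIAGONAL-LETTER NORMAL FORM: Conjecture B is a statement about pencils all of whose letters
# but two are DIAGONAL

HONEST FRAMING.  Helper bookkeeping for the OPEN crux `WeakLifting` (stmt-ValiantsHypothesis-19561, route `KPlusLogSqLaw`, cell
`pub-symmetroid`; seat val-sym-lift-p4 g25, 2026-08-29), continuing the real static normal form (`…KPlusLogSqLawRealStaticNormalForm`,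
Conjecture B ⟺ its static symmetric restriction).  Nothing here asserts `WeakLifting`, `TropicalB`, Conjecture B (`KPlusLogSqLaw`),
`MatrixDescartes` (stmt-ValiantsHypothesis-18050) or anything about VP ≠ VNP.

THE POINT.  Left-multiplying the Schur linearisation `G₁ = [[1, B], [C, 0]]` of `…RealStaticNormalForm` (`B = (X^{d p.2}·[p.1 = j])`,
`C = (−S p.2 i p.1)`, `det G₁ = det F`) by the block-diagonal `diag(X^{M − d p.2}) ⊕ 1` with `M = ∑ l, d l` moves every monomial onto the
DIAGONAL: `H = [[diag X^{M − d p.2}, X^M·W], [C, 0]]` (`W` = stacked identities) has `det H = (∏ p, X^{M − d p.2}) · det F` EXACTLY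
(`det_diagLetter`, any commutative ring, inverse-free).  `H` is a `(K+2)`-letter pencil of size `m·K + m` whose letters are: the constant
pattern `[[0,0],[−S,0]]` (exponent `0`), the constant pattern `[[0,W],[0,0]]` (exponent `M`), and `K` DIAGONAL `0/1` letters (exponents
`M − d l`) (`pencil_diagCoeff`).  Hence, row by row and with no hypothesis, `genRootLawAt_of_diagLetter`: general real pencils of format
`(m·K + m, K + 2)` ALL OF WHOSE LETTERS OF INDEX ≥ 2 ARE DIAGONAL bound the general row `GenRootLawAt m K` (the monomial factor only adds
the root `0`: `Census.card_roots_le_of_mul`), and `kPlusLogSqLaw_iff_genDiagLetter`: **Conjecture B ⟺ `∃ C`, every real (not necessarily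
symmetric) lacunary pencil of format `(n, K)` whose letters of index `≥ 2` are diagonal matrices has at most `2^(C (K + ⌊log₂ n⌋²))` distinct
real zeros of its determinant** (symmetry enters only through the same-`K` doubling `RealDoubling.genRootLawAt_of_realRootLawAt_double`).
READING (not used in proofs): up to the two constant-pattern letters, the determinant is the principal-minor polynomial
`det(A + diag(u)) = ∑_T u^T · det A[Tᶜ]` of a constant matrix evaluated on a monomial curve `u_p = X^{M − d p.2}`; for symmetric `A` the
polynomial `det(A + diag u)` is real stable (Borcea–Brändén), which is where a lifting mechanism for Conjecture B could be looked for.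
[folklore] block-diagonal scaling of a companion linearisation; principal-minor expansion.
-/

set_option linter.dupNamespace false
set_option autoImplicit false

namespace Summit.ValiantsHypothesis.ValiantsHypothesis.Theorems.KPlusLogSqLaw.RealStatic

open Summit.ValiantsHypothesis.ValiantsHypothesis.Theorems.LacunarySymmetroidMatrixDescartes (RealRootLawAt KPlusLogSqLaw)
open Summit.ValiantsHypothesis.ValiantsHypothesis.Theorems.LacunarySymmetroidMatrixDescartes.Census
  (realRootLawAt_mono card_roots_le_of_mul)
open Summit.ValiantsHypothesis.ValiantsHypothesis.Theorems.LacunarySymmetroidMatrixDescartes.TropicalCensus (realRootLawAt_zero)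
open Summit.ValiantsHypothesis.ValiantsHypothesis.Theorems.KPlusLogSqLaw.RealDoubling
  (GenRootLawAt realRootLawAt_of_genRootLawAt genRootLawAt_of_realRootLawAt_double)
open scoped BigOperators Matrix
open Polynomial

section Ring

variable {R : Type*} [CommRing R] {m K : ℕ}

/-- a single exponent is at most the sum of all exponents. [folklore] -/
theorem d_le_sum (d : Fin K → ℕ) (l : Fin K) : d l ≤ ∑ l', d l' :=
  Finset.single_le_sum (fun _ _ => Nat.zero_le _) (Finset.mem_univ l)

/-- **diagonal-letter linearisation, exact determinant**: with `M = ∑ l, d l`,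
`det [[diag X^{M − d p.2}, X^M·[p.1 = j]], [(−S p.2 i p.1), 0]] = (∏ p, X^{M − d p.2}) · det (∑ l, X^{d l} • S l)`. [folklore] -/
theorem det_diagLetter (d : Fin K → ℕ) (S : Fin K → Matrix (Fin m) (Fin m) R) :
    (Matrix.fromBlocks (Matrix.diagonal fun p : Fin m × Fin K => (X : R[X]) ^ (∑ l, d l - d p.2))
        (Matrix.of fun (p : Fin m × Fin K) (j : Fin m) => if p.1 = j then (X : R[X]) ^ (∑ l, d l) else 0)
        (Matrix.of fun (i : Fin m) (p : Fin m × Fin K) => Polynomial.C (-(S p.2 i p.1)))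
        (0 : Matrix (Fin m) (Fin m) R[X])).det
      = (∏ p : Fin m × Fin K, (X : R[X]) ^ (∑ l, d l - d p.2)) *
          (∑ l, (X : R[X]) ^ d l • (S l).map Polynomial.C).det := by
  set M := ∑ l, d l with hM
  have hfac : Matrix.fromBlocks (Matrix.diagonal fun p : Fin m × Fin K => (X : R[X]) ^ (M - d p.2))
        (Matrix.of fun (p : Fin m × Fin K) (j : Fin m) => if p.1 = j then (X : R[X]) ^ M else 0)
        (Matrix.of fun (i : Fin m) (p : Fin m × Fin K) => Polynomial.C (-(S p.2 i p.1)))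
        (0 : Matrix (Fin m) (Fin m) R[X])
      = Matrix.fromBlocks (Matrix.diagonal fun p : Fin m × Fin K => (X : R[X]) ^ (M - d p.2)) 0 0
          (1 : Matrix (Fin m) (Fin m) R[X]) *
        Matrix.fromBlocks (1 : Matrix (Fin m × Fin K) (Fin m × Fin K) R[X])
          (Matrix.of fun (p : Fin m × Fin K) (j : Fin m) => if p.1 = j then (X : R[X]) ^ d p.2 else 0)
          (Matrix.of fun (i : Fin m) (p : Fin m × Fin K) => Polynomial.C (-(S p.2 i p.1)))
          (0 : Matrix (Fin m) (Fin m) R[X]) := by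
    rw [Matrix.fromBlocks_multiply]
    simp only [Matrix.mul_one, Matrix.zero_mul, add_zero, Matrix.mul_zero, zero_add, Matrix.one_mul]
    congr 1
    ext p j
    rw [Matrix.diagonal_mul, Matrix.of_apply, Matrix.of_apply]
    by_cases h : p.1 = j
    · rw [if_pos h, if_pos h, ← pow_add, Nat.sub_add_cancel (d_le_sum d p.2)]
    · rw [if_neg h, if_neg h, mul_zero]
  rw [hfac, Matrix.det_mul, Matrix.det_fromBlocks_zero₂₁, Matrix.det_one, mul_one, Matrix.det_diagonal,
    det_linearization]

/-- the explicit coefficient family of the diagonal-letter linearisation (exponents `0`, `M`, then `M − d l`), written on the block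
index type, sums to `H`; letters of index `≥ 2` are DIAGONAL `0/1` matrices. [folklore] -/
theorem pencil_diagCoeff (d : Fin K → ℕ) (S : Fin K → Matrix (Fin m) (Fin m) R) :
    (∑ l', (X : R[X]) ^ (Fin.cons 0 (Fin.cons (∑ l, d l) fun l => ∑ l, d l - d l) : Fin (K + 2) → ℕ) l' •
        ((Fin.cons (Matrix.fromBlocks (0 : Matrix (Fin m × Fin K) (Fin m × Fin K) R) 0
              (Matrix.of fun (i : Fin m) (p : Fin m × Fin K) => -(S p.2 i p.1)) (0 : Matrix (Fin m) (Fin m) R))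
            (Fin.cons (Matrix.fromBlocks (0 : Matrix (Fin m × Fin K) (Fin m × Fin K) R)
                (Matrix.of fun (p : Fin m × Fin K) (j : Fin m) => if p.1 = j then (1 : R) else 0)
                0 (0 : Matrix (Fin m) (Fin m) R))
              (fun l : Fin K => Matrix.fromBlocks
                (Matrix.diagonal fun p : Fin m × Fin K => if p.2 = l then (1 : R) else 0)
                0 0 (0 : Matrix (Fin m) (Fin m) R))) :
            Fin (K + 2) → Matrix ((Fin m × Fin K) ⊕ Fin m) ((Fin m × Fin K) ⊕ Fin m) R) l').map Polynomial.C)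
      = Matrix.fromBlocks (Matrix.diagonal fun p : Fin m × Fin K => (X : R[X]) ^ (∑ l, d l - d p.2))
          (Matrix.of fun (p : Fin m × Fin K) (j : Fin m) => if p.1 = j then (X : R[X]) ^ (∑ l, d l) else 0)
          (Matrix.of fun (i : Fin m) (p : Fin m × Fin K) => Polynomial.C (-(S p.2 i p.1)))
          (0 : Matrix (Fin m) (Fin m) R[X]) := by
  refine Matrix.ext fun x y => ?_
  rw [Matrix.sum_apply, Fin.sum_univ_succ, Fin.sum_univ_succ]
  simp only [Fin.cons_zero, Fin.cons_succ, pow_zero, Matrix.smul_apply, Matrix.map_apply, smul_eq_mul, one_mul]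
  rcases x with p | i <;> rcases y with q | j
  · simp only [Matrix.fromBlocks_apply₁₁, Matrix.zero_apply, Polynomial.C_0, mul_zero, zero_add, Matrix.diagonal_apply,
      apply_ite Polynomial.C, Polynomial.C_1, mul_ite, mul_one]
    by_cases h : p = q
    · subst h
      simp only [if_true]
      rw [Finset.sum_ite_eq Finset.univ p.2 (fun l => (X : R[X]) ^ (∑ l', d l' - d l))]
      simp
    · simp [h]
  · simp [apply_ite Polynomial.C]
  · simp
  · simp

/-- the letters of index `≥ 2` of the diagonal-letter family are diagonal. [folklore] -/
theorem diagCoeff_offdiag (S : Fin K → Matrix (Fin m) (Fin m) R) (l' : Fin (K + 2)) (hl' : 2 ≤ (l' : ℕ))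
    (x y : (Fin m × Fin K) ⊕ Fin m) (hxy : x ≠ y) :
    (Fin.cons (Matrix.fromBlocks (0 : Matrix (Fin m × Fin K) (Fin m × Fin K) R) 0
          (Matrix.of fun (i : Fin m) (p : Fin m × Fin K) => -(S p.2 i p.1)) (0 : Matrix (Fin m) (Fin m) R))
        (Fin.cons (Matrix.fromBlocks (0 : Matrix (Fin m × Fin K) (Fin m × Fin K) R)
            (Matrix.of fun (p : Fin m × Fin K) (j : Fin m) => if p.1 = j then (1 : R) else 0)
            0 (0 : Matrix (Fin m) (Fin m) R))
          (fun l : Fin K => Matrix.fromBlocks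
            (Matrix.diagonal fun p : Fin m × Fin K => if p.2 = l then (1 : R) else 0)
            0 0 (0 : Matrix (Fin m) (Fin m) R))) :
        Fin (K + 2) → Matrix ((Fin m × Fin K) ⊕ Fin m) ((Fin m × Fin K) ⊕ Fin m) R) l' x y = 0 := by
  obtain ⟨l₁, rfl⟩ : ∃ l₁ : Fin (K + 1), l' = l₁.succ := ⟨l'.pred (by intro h; simp [h] at hl'), by simp⟩
  obtain ⟨l, rfl⟩ : ∃ l : Fin K, l₁ = l.succ :=
    ⟨l₁.pred (by intro h; simp [h] at hl'), by simp⟩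
  simp only [Fin.cons_succ]
  rcases x with p | i <;> rcases y with q | j
  · have hpq : p ≠ q := fun h => hxy (by rw [h])
    simp [Matrix.diagonal_apply_ne _ hpq]
  · simp
  · simp
  · simp

/-- **diagonal-letter linearisation, existence form** (any commutative ring): for every `K`-term `m × m` pencil there is an explicit
`(K+2)`-term pencil of size `m·K + m`, ALL OF WHOSE LETTERS OF INDEX ≥ 2 ARE DIAGONAL, whose determinant is the original determinant
times the monomial `∏ p, X^{M − d p.2}`. [folklore] -/
theorem exists_diagLetter_det_eq (d : Fin K → ℕ) (S : Fin K → Matrix (Fin m) (Fin m) R) :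
    ∃ (d' : Fin (K + 2) → ℕ) (E : Fin (K + 2) → Matrix (Fin (m * K + m)) (Fin (m * K + m)) R),
      (∀ l' : Fin (K + 2), 2 ≤ (l' : ℕ) → ∀ x y, x ≠ y → E l' x y = 0) ∧
      (∑ l', (X : R[X]) ^ d' l' • (E l').map Polynomial.C).det
        = (∏ p : Fin m × Fin K, (X : R[X]) ^ (∑ l, d l - d p.2)) * (∑ l, (X : R[X]) ^ d l • (S l).map Polynomial.C).det := by
  classical
  let e : (Fin m × Fin K) ⊕ Fin m ≃ Fin (m * K + m) := (Equiv.sumCongr finProdFinEquiv (Equiv.refl (Fin m))).trans finSumFinEquiv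
  let T : Fin (K + 2) → Matrix ((Fin m × Fin K) ⊕ Fin m) ((Fin m × Fin K) ⊕ Fin m) R :=
    Fin.cons (Matrix.fromBlocks (0 : Matrix (Fin m × Fin K) (Fin m × Fin K) R) 0
        (Matrix.of fun (i : Fin m) (p : Fin m × Fin K) => -(S p.2 i p.1)) (0 : Matrix (Fin m) (Fin m) R))
      (Fin.cons (Matrix.fromBlocks (0 : Matrix (Fin m × Fin K) (Fin m × Fin K) R)
          (Matrix.of fun (p : Fin m × Fin K) (j : Fin m) => if p.1 = j then (1 : R) else 0)
          0 (0 : Matrix (Fin m) (Fin m) R))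
        (fun l : Fin K => Matrix.fromBlocks
          (Matrix.diagonal fun p : Fin m × Fin K => if p.2 = l then (1 : R) else 0)
          0 0 (0 : Matrix (Fin m) (Fin m) R)))
  refine ⟨Fin.cons 0 (Fin.cons (∑ l, d l) fun l => ∑ l, d l - d l), fun l' => Matrix.reindex e e (T l'), ?_, ?_⟩
  · intro l' hl' x y hxy
    simp only [Matrix.reindex_apply, Matrix.submatrix_apply]
    exact diagCoeff_offdiag S l' hl' (e.symm x) (e.symm y) (fun h => hxy (e.symm.injective h))
  · have hre : (∑ l', (X : R[X]) ^ (Fin.cons 0 (Fin.cons (∑ l, d l) fun l => ∑ l, d l - d l) : Fin (K + 2) → ℕ) l' •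
          (Matrix.reindex e e (T l')).map Polynomial.C)
        = Matrix.reindex e e (∑ l', (X : R[X]) ^ (Fin.cons 0 (Fin.cons (∑ l, d l) fun l => ∑ l, d l - d l) :
            Fin (K + 2) → ℕ) l' • (T l').map Polynomial.C) := by
      refine Matrix.ext fun x y => ?_
      simp [Matrix.sum_apply]
    rw [hre, Matrix.det_reindex_self, pencil_diagCoeff, det_diagLetter]

end Ring

/-! ## Row transfer over `ℝ` and the equivalence with Conjecture B -/

section Rows

variable {m K : ℕ}

/-- the monomial factor of the diagonal-letter linearisation is a nonzero polynomial. [folklore] -/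
theorem prod_X_pow_ne_zero (d : Fin K → ℕ) :
    (∏ p : Fin m × Fin K, (X : ℝ[X]) ^ (∑ l, d l - d p.2)) ≠ 0 :=
  Finset.prod_ne_zero_iff.mpr fun _ _ => pow_ne_zero _ Polynomial.X_ne_zero

/-- **Diagonal-letter general rows bound general rows**: if every general real pencil of format `(m·K + m, K + 2)` whose letters of
index `≥ 2` are diagonal has at most `B` distinct real zeros of its determinant, then so does every general real pencil of format
`(m, K)` (the monomial factor can only add the root `0` on the big side). [folklore] -/
theorem genRootLawAt_of_diagLetter {B : ℕ}
    (h : ∀ (d' : Fin (K + 2) → ℕ) (E : Fin (K + 2) → Matrix (Fin (m * K + m)) (Fin (m * K + m)) ℝ),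
      (∀ l' : Fin (K + 2), 2 ≤ (l' : ℕ) → ∀ x y, x ≠ y → E l' x y = 0) →
      (Matrix.det (∑ l, ((Polynomial.X : Polynomial ℝ) ^ d' l) • (E l).map Polynomial.C)).roots.toFinset.card ≤ B) :
    GenRootLawAt m K B := by
  intro d S
  obtain ⟨d', E, hdiag, hdet⟩ := exists_diagLetter_det_eq (R := ℝ) d S
  have hbig := h d' E hdiag
  rw [hdet, mul_comm] at hbig
  exact ((card_roots_le_of_mul _ _ (prod_X_pow_ne_zero d)).1).trans hbig

/-- size arithmetic for the window case of the diagonal-letter transfer: with `L = ⌊log₂ m⌋`, `1 ≤ K` and `K + 1 ≤ m`, the size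
`N = m·K + m ≤ m²` has `⌊log₂ N⌋ ≤ 2L + 1`, hence `C((K+2) + ⌊log₂ N⌋²) ≤ 11·C·(K + L²)`. [folklore] -/
theorem diag_size_exponent_le (C m K : ℕ) (hK : 1 ≤ K) (hKm : K + 1 ≤ m) :
    C * ((K + 2) + Nat.log 2 (m * K + m) ^ 2) ≤ 11 * C * (K + Nat.log 2 m ^ 2) := by
  set L := Nat.log 2 m with hL
  have hm2 : 2 ≤ m := by omega
  have hL1 : 1 ≤ L := by
    rw [hL]; exact Nat.le_log_of_pow_le (by norm_num) (by simpa using hm2)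
  have hm : m < 2 ^ (L + 1) := Nat.lt_pow_succ_log_self one_lt_two m
  have hN : m * K + m < 2 ^ (2 * L + 2) := by
    have e1 : m * K + m = m * (K + 1) := by ring
    have e2 : m * (K + 1) ≤ m * m := Nat.mul_le_mul_left _ hKm
    have e3 : m * m < 2 ^ (L + 1) * 2 ^ (L + 1) := Nat.mul_lt_mul'' hm hm
    have e4 : 2 ^ (2 * L + 2) = 2 ^ (L + 1) * 2 ^ (L + 1) := by rw [← pow_add]; congr 1; omega
    omega
  have hlogN : Nat.log 2 (m * K + m) ≤ 2 * L + 1 := by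
    have hne : m * K + m ≠ 0 := by positivity
    have := Nat.log_lt_of_lt_pow hne hN
    omega
  have hsq : Nat.log 2 (m * K + m) ^ 2 ≤ 9 * L ^ 2 := by
    calc Nat.log 2 (m * K + m) ^ 2 ≤ (2 * L + 1) ^ 2 := Nat.pow_le_pow_left hlogN 2
      _ ≤ 9 * L ^ 2 := by nlinarith
  have h3 : (K + 2) + Nat.log 2 (m * K + m) ^ 2 ≤ 11 * (K + L ^ 2) := by nlinarith
  calc C * ((K + 2) + Nat.log 2 (m * K + m) ^ 2) ≤ C * (11 * (K + L ^ 2)) := Nat.mul_le_mul_left _ h3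
    _ = 11 * C * (K + L ^ 2) := by ring

/-- doubling arithmetic: `1 ≤ K ⇒ C(K + ⌊log₂ (n+n)⌋²) ≤ 3·C·(K + ⌊log₂ n⌋²)`. [folklore] -/
theorem double_size_exponent_le (C n K : ℕ) (hK : 1 ≤ K) :
    C * (K + Nat.log 2 (n + n) ^ 2) ≤ 3 * C * (K + Nat.log 2 n ^ 2) := by
  set L := Nat.log 2 n with hL
  have hlog : Nat.log 2 (n + n) ≤ L + 1 := by
    rcases Nat.eq_zero_or_pos n with rfl | hn
    · simp
    · have e : n + n = n * 2 := by ring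
      rw [e, Nat.log_mul_base one_lt_two hn.ne']
  have h1 : Nat.log 2 (n + n) ^ 2 ≤ (L + 1) ^ 2 := Nat.pow_le_pow_left hlog 2
  have h2 : K + (L + 1) ^ 2 ≤ 3 * (K + L ^ 2) := by nlinarith
  calc C * (K + Nat.log 2 (n + n) ^ 2) ≤ C * (3 * (K + L ^ 2)) := Nat.mul_le_mul_left _ (by omega)
    _ = 3 * C * (K + L ^ 2) := by ring

/-- **Conjecture B ⟺ Conjecture B for GENERAL pencils whose letters of index ≥ 2 are DIAGONAL.**  `→`: Conjecture B bounds the general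
rows through the same-`K` doubling (`RealDoubling.genRootLawAt_of_realRootLawAt_double`), in particular the diagonal-letter ones;
`←`: off the fat cone (`m ≤ K`) Conjecture B is a Descartes theorem (`realRootLawAt_fatCone_zero`); for `K < m`, `genRootLawAt_of_diagLetter` at format `(m·K + m, K + 2)` and `diag_size_exponent_le`.  An EQUIVALENCE between OPEN statements;
neither side is asserted. [folklore] -/
theorem kPlusLogSqLaw_iff_genDiagLetter :
    KPlusLogSqLaw ↔ ∃ C : ℕ, ∀ (n K' : ℕ) (d : Fin K' → ℕ) (E : Fin K' → Matrix (Fin n) (Fin n) ℝ),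
      (∀ l : Fin K', 2 ≤ (l : ℕ) → ∀ x y, x ≠ y → E l x y = 0) →
      (Matrix.det (∑ l, ((Polynomial.X : Polynomial ℝ) ^ d l) • (E l).map Polynomial.C)).roots.toFinset.card
        ≤ 2 ^ (C * (K' + Nat.log 2 n ^ 2)) := by
  constructor
  · rintro ⟨C, hC⟩
    refine ⟨3 * C, fun n K' d E _ => ?_⟩
    rcases Nat.eq_zero_or_pos K' with rfl | hK
    · exact realRootLawAt_zero n _ d E (fun l => l.elim0)
    have hgen : GenRootLawAt n K' (2 ^ (C * (K' + Nat.log 2 (n + n) ^ 2))) :=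
      genRootLawAt_of_realRootLawAt_double (hC (n + n) K')
    exact (hgen d E).trans (Nat.pow_le_pow_right two_pos (double_size_exponent_le C n K' hK))
  · rintro ⟨C, hC⟩
    refine ⟨11 * C + 2, fun m K => ?_⟩
    rcases Nat.eq_zero_or_pos K with rfl | hK
    · exact realRootLawAt_zero m _
    by_cases hmK : m ≤ K
    · -- fat cone `m ≤ K`: Descartes (`realRootLawAt_fatCone_zero` of `…RealStaticNormalForm`)
      refine realRootLawAt_mono ?_ (realRootLawAt_fatCone_zero m K hmK)
      exact Nat.pow_le_pow_right two_pos (Nat.mul_le_mul_right _ (by omega))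
    · have hKm : K + 1 ≤ m := by omega
      refine realRootLawAt_mono ?_ (realRootLawAt_of_genRootLawAt
        (genRootLawAt_of_diagLetter fun d' E hdiag => hC _ _ d' E hdiag))
      exact Nat.pow_le_pow_right two_pos
        ((diag_size_exponent_le C m K hK hKm).trans (Nat.mul_le_mul_right _ (by omega)))

end Rows

end Summit.ValiantsHypothesis.ValiantsHypothesis.Theorems.KPlusLogSqLaw.RealStatic
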